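import Mathlib
import HarnessLib

/-!
# Stub `stub_uniformizer` for the crux `TwoAdicBianchiProModularityLevel` (line `Sketch`)

Every finite place `v` of a number field `K` has a uniformiser in the completion `K_v`, i.e. a
unit of `K_v` of valuation `exp(-1)`.  Pure Mathlib: a global uniformiser `π ∈ K` of the `v`-adic
valuation exists (`IsDedekindDomain.HeightOneSpectrum.valuation_exists_uniformizer`), it is
nonzero, and its image in `K_v` keeps its valuation
(`IsDedekindDomain.HeightOneSpectrum.valuedAdicCompletion_eq_valuation'`).
-/

set_option linter.dupNamespace false -- `Summit.Langlands.Langlands` is the mandated namespace (D-0017)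

open scoped NumberField
open IsDedekindDomain

namespace Summit.Langlands.Langlands.Theorems.TwoAdicBianchiProModularityLevel

/-- Every finite place `v` of a number field `K` has a uniformiser in the completion `K_v`: a unit
`u : K_vˣ` with `Valued.v u = exp(-1)`.  Take the image in `K_v` of a global uniformiser
`π ∈ K` (Mathlib `valuation_exists_uniformizer`); it is nonzero since its valuation is. [folklore] -/
theorem stub_uniformizer : ∀ (K : Type) [Field K] [NumberField K]
    (v : HeightOneSpectrum (𝓞 K)),
    ∃ u : (v.adicCompletion K)ˣ, Valued.v ((u : (v.adicCompletion K)ˣ) : v.adicCompletion K) =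
      WithZero.exp (-1 : ℤ) := by
  intro K _ _ v
  obtain ⟨π, hπ⟩ := v.valuation_exists_uniformizer K
  have hv : Valued.v ((π : K) : v.adicCompletion K) = WithZero.exp (-1 : ℤ) := by
    rw [HeightOneSpectrum.valuedAdicCompletion_eq_valuation', hπ]
  have hπ0 : ((π : K) : v.adicCompletion K) ≠ 0 := by
    intro h
    rw [h, map_zero] at hv
    exact WithZero.coe_ne_zero hv.symm
  exact ⟨Units.mk0 _ hπ0, by rw [Units.val_mk0, hv]⟩

end Summit.Langlands.Langlands.Theorems.TwoAdicBianchiProModularityLevel
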